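import Summits.PneNP.PneNP.Theorems.SfmBlMachineDictCount
import Summits.PneNP.PneNP.Theorems.Sd2BlMachineDictPieces

/-!
# K1'' machine side (S3), DICTIONARY D1c (generic): the number of pieces of the block-split raw legs

Cell pnp-ideate, ROUND-18 item K1''; twin of `SfmBlMachineDictCount` with `trips ↦ raw` (generic in the raw-leg list
of `Sd2BlMachineLegs`).  The piece-count hypotheses `hN1 : 1 ≤ |α| + |β|` and `hN : |α| + |β| ≤ …` of
`Sd2Bl.legBound_of_pipeline` for the piece structure of D1 (`LPieceG L raw`, `RPieceG L raw`): a left label is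
`(0, c, rank/L)` with `rank <` the size `D_c` of the fibre of the owner code `c`, so at most `(D_c − 1)/L + 1` blocks
per owner code and `Σ_c D_c ≤ |raw|`; with all left owner codes `< V` this gives `|α| ≤ V + |raw|/L`
(`card_LPieceG_le`), likewise on the right (`card_RPieceG_le`), together `card_piecesG_le_real`
(`|α| + |β| ≤ V₁ + V₂ + 2|raw|/L` over `ℝ`), and `one_le_card_piecesG` for a nonempty leg list.  (For the canonical
legs of a `k`-local instance: owner codes `< 2n + 2`, `|raw| ≤ ℓ·m`, whence `≤ 8n + 2ℓm/L` once `n ≥ 1` — the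
instance bookkeeping is downstream.)  Restricted-model algorithmic infrastructure; nothing here bears on `P` versus `NP`.
-/

set_option linter.dupNamespace false -- `Summit.PneNP.PneNP.…`: summit = sub-problem name (D-0017 single-conjunct layout)

namespace Summit.PneNP.PneNP.Theorems.Sd2BlMachine

open Literature.Computability.Complexity
open Summit.PneNP.PneNP.Theorems.SfmBlMachine (Lab PLeg labL labR sum_div_le_sum_div)

/-- The left fibre size of owner code `c`. -/
def fibLG (raw : List RLeg) (c : ℕ) : ℕ := ((List.range raw.length).filter fun i => lvertG raw i = c).length

/-- The right fibre size of owner code `v`. -/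
def fibRG (raw : List RLeg) (v : ℕ) : ℕ := ((List.range raw.length).filter fun i => rvertG raw i = v).length

/-- The left rank is below the fibre size. -/
theorem rankLG_lt_fibLG (raw : List RLeg) {i : ℕ} (hi : i < raw.length) : rankLG raw i < fibLG raw (lvertG raw i) := by
  unfold fibLG
  rw [rankLG_eq_countP raw hi, ← List.countP_eq_length_filter]
  have hsub : List.Sublist (List.range (i + 1)) (List.range raw.length) := List.range_sublist.2 hi
  have h1 := hsub.countP_le (p := fun k => decide (lvertG raw k = lvertG raw i))
  rw [List.range_succ, List.countP_append] at h1
  have h2 : List.countP (fun k => decide (lvertG raw k = lvertG raw i)) [i] = 1 := by simp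
  omega

/-- The right rank is below the fibre size. -/
theorem rankRG_lt_fibRG (raw : List RLeg) {i : ℕ} (hi : i < raw.length) : rankRG raw i < fibRG raw (rvertG raw i) := by
  unfold fibRG
  rw [rankRG_eq_countP raw hi, ← List.countP_eq_length_filter]
  have hsub : List.Sublist (List.range (i + 1)) (List.range raw.length) := List.range_sublist.2 hi
  have h1 := hsub.countP_le (p := fun k => decide (rvertG raw k = rvertG raw i))
  rw [List.range_succ, List.countP_append] at h1
  have h2 : List.countP (fun k => decide (rvertG raw k = rvertG raw i)) [i] = 1 := by simp
  omega

/-- The fibres partition the legs: `Σ_{c < B} D_c ≤ |raw|`. -/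
theorem sum_fibLG_le (raw : List RLeg) (B : ℕ) : ∑ c ∈ Finset.range B, fibLG raw c ≤ raw.length := by
  classical
  have h := Finset.card_eq_sum_card_fiberwise (s := (Finset.range raw.length).filter fun i => lvertG raw i < B)
    (t := Finset.range B) (f := lvertG raw) (fun i hi => Finset.mem_range.2 (Finset.mem_filter.1 hi).2)
  have hle : ((Finset.range raw.length).filter fun i => lvertG raw i < B).card ≤ raw.length :=
    (Finset.card_filter_le _ _).trans (by simp)
  rw [h] at hle
  refine le_trans (Finset.sum_le_sum fun c hc => ?_) hle
  unfold fibLG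
  have : ((Finset.range raw.length).filter fun i => lvertG raw i < B).filter (fun i => lvertG raw i = c)
      = (Finset.range raw.length).filter fun i => lvertG raw i = c := by
    ext i; simp only [Finset.mem_filter, Finset.mem_range]
    constructor
    · rintro ⟨⟨h1, _⟩, h3⟩; exact ⟨h1, h3⟩
    · rintro ⟨h1, h3⟩; exact ⟨⟨h1, by rw [h3]; exact Finset.mem_range.1 hc⟩, h3⟩
  rw [this]
  exact le_of_eq (by rfl)

/-- Same on the right. -/
theorem sum_fibRG_le (raw : List RLeg) (B : ℕ) : ∑ v ∈ Finset.range B, fibRG raw v ≤ raw.length := by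
  classical
  have h := Finset.card_eq_sum_card_fiberwise (s := (Finset.range raw.length).filter fun i => rvertG raw i < B)
    (t := Finset.range B) (f := rvertG raw) (fun i hi => Finset.mem_range.2 (Finset.mem_filter.1 hi).2)
  have hle : ((Finset.range raw.length).filter fun i => rvertG raw i < B).card ≤ raw.length :=
    (Finset.card_filter_le _ _).trans (by simp)
  rw [h] at hle
  refine le_trans (Finset.sum_le_sum fun c hc => ?_) hle
  unfold fibRG
  have : ((Finset.range raw.length).filter fun i => rvertG raw i < B).filter (fun i => rvertG raw i = c)
      = (Finset.range raw.length).filter fun i => rvertG raw i = c := by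
    ext i; simp only [Finset.mem_filter, Finset.mem_range]
    constructor
    · rintro ⟨⟨h1, _⟩, h3⟩; exact ⟨h1, h3⟩
    · rintro ⟨h1, h3⟩; exact ⟨⟨h1, by rw [h3]; exact Finset.mem_range.1 hc⟩, h3⟩
  rw [this]
  exact le_of_eq (by rfl)

/-- **LEFT PIECES**: if all left owner codes are `< V`, there are at most `V + |raw|/L` left pieces. -/
theorem card_LPieceG_le {L : ℕ} (hL : 0 < L) (raw : List RLeg) {V : ℕ} (hV : ∀ i, i < raw.length → lvertG raw i < V) :
    Fintype.card (LPieceG L raw) ≤ V + raw.length / L := by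
  classical
  let box : Finset Lab := (Finset.range V).biUnion fun c =>
    (Finset.range ((fibLG raw c - 1) / L + 1)).image fun b => ((0 : ℕ), c, b)
  have hmem : ∀ P : LPieceG L raw, P.1 ∈ box := by
    intro P
    obtain ⟨x, hx, hP⟩ := List.mem_map.1 P.2
    obtain ⟨i, hi, rfl⟩ := (mem_pieceLegsG_iff L raw x).1 hx
    rw [← hP, labL_plegG]
    have hr := rankLG_lt_fibLG raw hi
    refine Finset.mem_biUnion.2 ⟨lvertG raw i, Finset.mem_range.2 (hV i hi), Finset.mem_image.2 ⟨_, Finset.mem_range.2 ?_, rfl⟩⟩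
    have : rankLG raw i / L ≤ (fibLG raw (lvertG raw i) - 1) / L := Nat.div_le_div_right (by omega)
    omega
  have hcard : Fintype.card (LPieceG L raw) ≤ box.card := by
    rw [← Finset.card_univ]
    refine Finset.card_le_card_of_injOn (fun P => P.1) (fun P _ => by exact hmem P) ?_
    intro a _ b _ h; exact Subtype.ext h
  refine hcard.trans ?_
  calc box.card ≤ ∑ c ∈ Finset.range V, ((Finset.range ((fibLG raw c - 1) / L + 1)).image fun b => ((0 : ℕ), c, b)).card :=
        Finset.card_biUnion_le
    _ ≤ ∑ c ∈ Finset.range V, ((fibLG raw c - 1) / L + 1) :=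
        Finset.sum_le_sum fun c _ => Finset.card_image_le.trans (by simp)
    _ = ∑ c ∈ Finset.range V, (fibLG raw c - 1) / L + V := by
        rw [Finset.sum_add_distrib, Finset.sum_const, Finset.card_range, smul_eq_mul, mul_one]
    _ ≤ (∑ c ∈ Finset.range V, fibLG raw c) / L + V := by
        refine Nat.add_le_add_right ((sum_div_le_sum_div _ _ hL).trans (Nat.div_le_div_right
          (Finset.sum_le_sum fun c _ => Nat.sub_le _ _))) _
    _ ≤ raw.length / L + V := Nat.add_le_add_right (Nat.div_le_div_right (sum_fibLG_le raw V)) _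
    _ = V + raw.length / L := by omega

/-- **RIGHT PIECES**: if all right owner codes are `< V`, there are at most `V + |raw|/L` right pieces. -/
theorem card_RPieceG_le {L : ℕ} (hL : 0 < L) (raw : List RLeg) {V : ℕ} (hV : ∀ i, i < raw.length → rvertG raw i < V) :
    Fintype.card (RPieceG L raw) ≤ V + raw.length / L := by
  classical
  let box : Finset Lab := (Finset.range V).biUnion fun v =>
    (Finset.range ((fibRG raw v - 1) / L + 1)).image fun b => ((1 : ℕ), v, b)
  have hmem : ∀ Q : RPieceG L raw, Q.1 ∈ box := by
    intro Q
    obtain ⟨x, hx, hQ⟩ := List.mem_map.1 Q.2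
    obtain ⟨i, hi, rfl⟩ := (mem_pieceLegsG_iff L raw x).1 hx
    rw [← hQ, labR_plegG]
    have hr := rankRG_lt_fibRG raw hi
    refine Finset.mem_biUnion.2 ⟨rvertG raw i, Finset.mem_range.2 (hV i hi), Finset.mem_image.2 ⟨_, Finset.mem_range.2 ?_, rfl⟩⟩
    have : rankRG raw i / L ≤ (fibRG raw (rvertG raw i) - 1) / L := Nat.div_le_div_right (by omega)
    omega
  have hcard : Fintype.card (RPieceG L raw) ≤ box.card := by
    rw [← Finset.card_univ]
    refine Finset.card_le_card_of_injOn (fun Q => Q.1) (fun Q _ => by exact hmem Q) ?_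
    intro a _ b _ h; exact Subtype.ext h
  refine hcard.trans ?_
  calc box.card ≤ ∑ v ∈ Finset.range V, ((Finset.range ((fibRG raw v - 1) / L + 1)).image fun b => ((1 : ℕ), v, b)).card :=
        Finset.card_biUnion_le
    _ ≤ ∑ v ∈ Finset.range V, ((fibRG raw v - 1) / L + 1) :=
        Finset.sum_le_sum fun v _ => Finset.card_image_le.trans (by simp)
    _ = ∑ v ∈ Finset.range V, (fibRG raw v - 1) / L + V := by
        rw [Finset.sum_add_distrib, Finset.sum_const, Finset.card_range, smul_eq_mul, mul_one]
    _ ≤ (∑ v ∈ Finset.range V, fibRG raw v) / L + V := by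
        refine Nat.add_le_add_right ((sum_div_le_sum_div _ _ hL).trans (Nat.div_le_div_right
          (Finset.sum_le_sum fun v _ => Nat.sub_le _ _))) _
    _ ≤ raw.length / L + V := Nat.add_le_add_right (Nat.div_le_div_right (sum_fibRG_le raw V)) _
    _ = V + raw.length / L := by omega

/-- **hN, generic**: `|α| + |β| ≤ V₁ + V₂ + 2|raw|/L` (reals) when the left / right owner codes are `< V₁` / `< V₂`. -/
theorem card_piecesG_le_real {L : ℕ} (hL : 0 < L) (raw : List RLeg) {V₁ V₂ : ℕ}
    (hV₁ : ∀ i, i < raw.length → lvertG raw i < V₁) (hV₂ : ∀ i, i < raw.length → rvertG raw i < V₂) :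
    ((Fintype.card (LPieceG L raw) : ℝ) + Fintype.card (RPieceG L raw)) ≤ V₁ + V₂ + 2 * (raw.length : ℝ) / L := by
  have h1 := card_LPieceG_le hL raw hV₁
  have h2 := card_RPieceG_le hL raw hV₂
  have hdiv : ((raw.length / L : ℕ) : ℝ) ≤ (raw.length : ℝ) / L := Nat.cast_div_le
  have e1 : (Fintype.card (LPieceG L raw) : ℝ) ≤ V₁ + ((raw.length / L : ℕ) : ℝ) := by exact_mod_cast h1
  have e2 : (Fintype.card (RPieceG L raw) : ℝ) ≤ V₂ + ((raw.length / L : ℕ) : ℝ) := by exact_mod_cast h2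
  have : 2 * (raw.length : ℝ) / L = raw.length / L + raw.length / L := by ring
  rw [this]; linarith

/-- **hN1, generic**: a nonempty leg list has at least one piece. -/
theorem one_le_card_piecesG (L : ℕ) (raw : List RLeg) (h : 0 < raw.length) :
    1 ≤ Fintype.card (LPieceG L raw) + Fintype.card (RPieceG L raw) := by
  have : 0 < Fintype.card (LPieceG L raw) := Fintype.card_pos_iff.2 ⟨srcG L raw ⟨0, h⟩⟩
  omega

end Summit.PneNP.PneNP.Theorems.Sd2BlMachine
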